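import Mathlib.MeasureTheory.Function.Holder
import Mathlib.MeasureTheory.Integral.Lebesgue.Countable
import Mathlib.MeasureTheory.Measure.WithDensity
import Mathlib.Analysis.Normed.Operator.BanachSteinhaus
import Mathlib.Analysis.Normed.Operator.Mul
import Literature.Analysis.FunctionSpaces.WeakCompactnessL1
import Literature.Analysis.FunctionSpaces.VitaliHahnSaks
import HarnessLib

/-!
# The Dunford–Pettis theorem, necessity direction: proof

Analysis/FunctionSpaces proof file for `Literature.Analysis.FunctionSpaces.WeakCompactnessL1`:
the named fact `Literature.Analysis.FunctionSpaces.dunfordPettis_necessary` (Fonseca–Leoni 2007,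
Thm 2.54, necessity = Step 1 of the proof; Cercignani–Illner–Pulvirenti 1994 §5.3 Step 8
(i) ⇒ (ii)) is **discharged**:

* `Literature.Analysis.FunctionSpaces.dunfordPettis_necessary_holds : dunfordPettis_necessary` —
  on a `σ`-finite measure space a sequence of integrable real functions converging weakly in `L¹`
  (`Literature.Analysis.FunctionSpaces.TendstoWeaklyL1`: against every essentially bounded
  multiplier) is uniformly integrable (`MeasureTheory.UniformIntegrable f 1 μ`: bounded in `L¹`
  and equi-integrable) and uniformly tight (`MeasureTheory.UnifTight f 1 μ`).
* `Literature.Analysis.FunctionSpaces.exists_forall_integral_abs_le_of_integral_mul_bounded`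
  (**proved**; Fonseca–Leoni 2007 Prop A.68 with Thm A.44 (Banach–Steinhaus)): a sequence in
  `L¹(μ)` which is weakly bounded — `sup_n |∫ f n φ dμ| < ∞` for every `φ ∈ L^∞(μ)` — is bounded
  in `L¹(μ)`.

Proof, following Fonseca–Leoni 2007, proof of Thm 2.54, Step 1. *Substep 1a* (`L¹` bound):
the functionals `φ ↦ ∫ f n φ dμ` on the Banach space `L^∞(μ)` (`MeasureTheory.Lp ℝ ∞ μ`, via
`ContinuousLinearMap.lpPairing`) are pointwise bounded, hence uniformly bounded by
`banach_steinhaus`, and `‖f n‖₁ = ∫ f n · sign (f n) dμ ≤ ‖φ ↦ ∫ f n φ‖`. *Substeps 1b–1c*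
(equi-integrability and tightness) in one stroke: let `0 < d ≤ 1` be a `μ`-integrable density
(`MeasureTheory.exists_pos_lintegral_lt_of_sigmaFinite`) and `μ' = d • μ`, a finite measure with
`μ' ≤ μ` and the same null sets; each `s ↦ ∫_s |f n| dμ = ∫_s |f n| d⁻¹ dμ'` is absolutely
continuous with respect to `μ'`, and `∫ f n φ dμ` converges for every `[0,1]`-valued `φ`, so the
Vitali–Hahn–Saks theorem (`Literature.Analysis.FunctionSpaces.vitaliHahnSaks_setIntegral`,
Fonseca–Leoni Thm 2.53) gives `δ` with `|∫_s f n dμ| ≤ ε/2` for all `n` whenever `μ' s < δ`, hence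
`‖1_s f n‖₁ ≤ ε` (`eLpNorm_indicator_le_of_forall_abs_setIntegral_le`). Sets with `μ s ≤ δ' < δ`
qualify (`μ' ≤ μ`): equi-integrability; and since `μ'` is finite, the complement of a large
enough spanning set `S_k` of `μ` qualifies: uniform tightness.

## References

* I. Fonseca, G. Leoni, *Modern Methods in the Calculus of Variations: `L^p` Spaces*, Springer
  (2007), Thm 2.54 (Dunford–Pettis), p. 175, proof Step 1; Thm 2.53 (Vitali–Hahn–Saks);
  Prop A.68 and Thm A.44 (Banach–Steinhaus).
* C. Cercignani, R. Illner, M. Pulvirenti, *The Mathematical Theory of Dilute Gases*, Springer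
  (1994), §5.3 Step 8.
-/

noncomputable section

open MeasureTheory Filter Set Topology
open scoped ENNReal NNReal

namespace Literature.Analysis.FunctionSpaces

variable {α : Type*} [MeasurableSpace α] {μ : Measure α}

/-- **Weakly bounded sequences in `L¹` are norm bounded** (Fonseca–Leoni 2007 Prop A.68 — weakly
convergent sequences in a Banach space are bounded — through Thm A.44 (Banach–Steinhaus) and the
isometric embedding `L¹(μ) ↪ (L^∞(μ))'`). If `f n ∈ L¹(μ)` and for every a.e. strongly measurable,
essentially bounded multiplier `φ` the pairings `∫ f n φ dμ` are bounded in `n`, then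
`sup_n ∫ |f n| dμ < ∞`. Proof: `banach_steinhaus` for the functionals `φ ↦ ∫ f n φ dμ` on
`MeasureTheory.Lp ℝ ∞ μ` (`ContinuousLinearMap.lpPairing`), and `∫ |f n| dμ = ∫ f n · sign (f n) dμ`.
[cite: FonsecaLeoni2007, Prop A.68] -/
theorem exists_forall_integral_abs_le_of_integral_mul_bounded {f : ℕ → α → ℝ}
    (hf : ∀ n, Integrable (f n) μ)
    (hbdd : ∀ (φ : α → ℝ) (C : ℝ), AEStronglyMeasurable φ μ → (∀ᵐ x ∂μ, |φ x| ≤ C) →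
      ∃ M : ℝ, ∀ n, |∫ x, f n x * φ x ∂μ| ≤ M) :
    ∃ C : ℝ, ∀ n, ∫ x, |f n x| ∂μ ≤ C := by
  -- the functionals `T n : L^∞ → ℝ`, `φ ↦ ∫ f n · φ`
  set T : ℕ → (Lp ℝ ∞ μ →L[ℝ] ℝ) := fun n =>
    (ContinuousLinearMap.mul ℝ ℝ).lpPairing μ 1 ∞ ((hf n).toL1 (f n)) with hT_def
  have hT : ∀ n (φ : Lp ℝ ∞ μ), T n φ = ∫ x, f n x * φ x ∂μ := by
    intro n φ
    rw [hT_def]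
    dsimp only
    rw [ContinuousLinearMap.lpPairing_eq_integral]
    refine integral_congr_ae ?_
    filter_upwards [(hf n).coeFn_toL1] with x hx
    rw [ContinuousLinearMap.mul_apply', hx]
  -- pointwise boundedness
  have hpt : ∀ φ : Lp ℝ ∞ μ, ∃ M, ∀ n, ‖T n φ‖ ≤ M := by
    intro φ
    have hφb : ∀ᵐ x ∂μ, |φ x| ≤ ‖φ‖ := by
      have h1 : ∀ᵐ x ∂μ, ‖(φ : α → ℝ) x‖ₑ ≤ eLpNormEssSup (φ : α → ℝ) μ := ae_le_eLpNormEssSup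
      filter_upwards [h1] with x hx
      rw [← eLpNorm_exponent_top, ← Lp.enorm_def, ← ofReal_norm, ← ofReal_norm,
        ENNReal.ofReal_le_ofReal_iff (norm_nonneg _)] at hx
      simpa only [Real.norm_eq_abs] using hx
    obtain ⟨M, hM⟩ := hbdd φ ‖φ‖ (Lp.memLp φ).1 hφb
    exact ⟨M, fun n => by rw [hT, Real.norm_eq_abs]; exact hM n⟩
  obtain ⟨C, hC⟩ := banach_steinhaus hpt
  refine ⟨C, fun n => le_trans ?_ (hC n)⟩
  -- `∫ |f n| = T n (sign (f n)) ≤ ‖T n‖`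
  set g : α → ℝ := (hf n).1.mk (f n) with hg_def
  have hg_meas : StronglyMeasurable g := (hf n).1.stronglyMeasurable_mk
  have hfg : f n =ᵐ[μ] g := (hf n).1.ae_eq_mk
  set ψ₀ : α → ℝ := fun x => if 0 ≤ g x then 1 else -1 with hψ₀_def
  have hψ₀_meas : Measurable ψ₀ :=
    Measurable.ite (measurableSet_le measurable_const hg_meas.measurable) measurable_const
      measurable_const
  have hψ₀_bdd : ∀ᵐ x ∂μ, ‖ψ₀ x‖ ≤ 1 := Eventually.of_forall fun x => by
    by_cases hx : 0 ≤ g x <;> simp [hψ₀_def, hx]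
  have hψ₀_mem : MemLp ψ₀ ∞ μ := memLp_top_of_bound hψ₀_meas.aestronglyMeasurable 1 hψ₀_bdd
  set ψ : Lp ℝ ∞ μ := hψ₀_mem.toLp ψ₀ with hψ_def
  have hψ_norm : ‖ψ‖ ≤ 1 := by
    rw [hψ_def, Lp.norm_toLp, eLpNorm_exponent_top]
    have := eLpNormEssSup_le_of_ae_bound hψ₀_bdd
    calc (eLpNormEssSup ψ₀ μ).toReal ≤ (ENNReal.ofReal 1).toReal :=
          ENNReal.toReal_mono ENNReal.ofReal_ne_top this
      _ = 1 := by simp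
  have hTψ : T n ψ = ∫ x, |f n x| ∂μ := by
    rw [hT]
    refine integral_congr_ae ?_
    filter_upwards [hψ₀_mem.coeFn_toLp, hfg] with x hx hx'
    rw [hx, hx', hψ₀_def]
    dsimp only
    by_cases h0 : 0 ≤ g x
    · rw [if_pos h0, mul_one, abs_of_nonneg h0]
    · rw [if_neg h0, mul_neg_one, abs_of_neg (not_le.1 h0)]
  calc ∫ x, |f n x| ∂μ = T n ψ := hTψ.symm
    _ ≤ ‖T n ψ‖ := Real.le_norm_self _
    _ ≤ ‖T n‖ * ‖ψ‖ := (T n).le_opNorm ψ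
    _ ≤ ‖T n‖ * 1 := by gcongr
    _ = ‖T n‖ := mul_one _

/-- **The Dunford–Pettis theorem, necessity direction** — discharge of the named fact
`Literature.Analysis.FunctionSpaces.dunfordPettis_necessary` (Fonseca–Leoni 2007 Thm 2.54,
necessity, Step 1 of the proof; CIP 1994 §5.3 Step 8 (i) ⇒ (ii)): on a `σ`-finite measure space,
a sequence of integrable real functions converging weakly in `L¹` (against all essentially
bounded multipliers) is bounded in `L¹`, equi-integrable and uniformly tight. The `L¹` bound is
`exists_forall_integral_abs_le_of_integral_mul_bounded` (Banach–Steinhaus); equi-integrability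
and tightness both follow from the Vitali–Hahn–Saks theorem `vitaliHahnSaks_setIntegral` applied
with the finite equivalent measure `μ' = d • μ`, `0 < d ≤ 1` integrable (see the module
docstring). The integrability of the weak limit `g` is not used. [cite: FonsecaLeoni2007, Thm 2.54] -/
theorem dunfordPettis_necessary_holds : dunfordPettis_necessary := by
  intro α _ μ _ f g hf _ hw
  -- (a) the `L¹` bound (Banach–Steinhaus)
  have hbound : ∃ C : ℝ≥0, ∀ n, eLpNorm (f n) 1 μ ≤ C := by
    obtain ⟨C, hC⟩ := exists_forall_integral_abs_le_of_integral_mul_bounded hf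
      (fun φ C hφ hφC => by
        obtain ⟨M, hM⟩ := isBounded_iff_forall_norm_le.1
          (Metric.isBounded_range_of_tendsto _ (hw φ C hφ hφC))
        exact ⟨M, fun n => by simpa only [Real.norm_eq_abs] using hM _ (mem_range_self n)⟩)
    refine ⟨C.toNNReal, fun n => ?_⟩
    rw [eLpNorm_one_eq_lintegral_enorm, ← ofReal_integral_norm_eq_lintegral_enorm (hf n)]
    simp only [Real.norm_eq_abs]
    exact ENNReal.ofReal_le_ofReal (hC n)
  -- (b) a finite measure `μ' = d • μ`, `0 < d ≤ 1`, with the same null sets as `μ`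
  obtain ⟨h, hpos, hmeas, hint⟩ := exists_pos_lintegral_lt_of_sigmaFinite μ one_ne_zero
  set d : α → ℝ≥0∞ := fun x => ((min (h x) 1 : ℝ≥0) : ℝ≥0∞) with hd_def
  have hd_meas : Measurable d := (hmeas.min measurable_const).coe_nnreal_ennreal
  have hd_pos : ∀ x, d x ≠ 0 := fun x => by
    simp only [hd_def, ne_eq, ENNReal.coe_eq_zero]
    exact (lt_min (hpos x) one_pos).ne'
  have hd_le_one : ∀ x, d x ≤ 1 := fun x => by
    simp only [hd_def]
    exact_mod_cast min_le_right _ _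
  have hd_top : ∀ x, d x ≠ ∞ := fun x => ENNReal.coe_ne_top
  have hd_int : ∫⁻ x, d x ∂μ ≠ ∞ := by
    refine ne_top_of_le_ne_top (ne_top_of_lt hint) (lintegral_mono fun x => ?_)
    simp only [hd_def]
    exact ENNReal.coe_le_coe.2 (min_le_left _ _)
  set μ' : Measure α := μ.withDensity d with hμ'_def
  haveI : IsFiniteMeasure μ' := isFiniteMeasure_withDensity hd_int
  have hμ'le : μ' ≤ μ := by
    calc μ' = μ.withDensity d := rfl
      _ ≤ μ.withDensity 1 := withDensity_mono (Eventually.of_forall fun x => hd_le_one x)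
      _ = μ := withDensity_one
  have hμμ' : μ ≪ μ' :=
    withDensity_absolutelyContinuous' hd_meas.aemeasurable (Eventually.of_forall hd_pos)
  have hμ'μ : μ' ≪ μ := withDensity_absolutelyContinuous μ d
  have hμeq : μ'.withDensity (fun x => (d x)⁻¹) = μ :=
    withDensity_inv_same hd_meas (Eventually.of_forall hd_pos) (Eventually.of_forall hd_top)
  -- (c) each `ν_n = f n • μ` is absolutely continuous with respect to `μ'`, quantitatively
  have hac : ∀ n, ∀ ε : ℝ≥0∞, ε ≠ 0 → ∃ δ : ℝ≥0∞, 0 < δ ∧ ∀ s, MeasurableSet s → μ' s < δ →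
      ∫⁻ x in s, ‖f n x‖ₑ ∂μ < ε := by
    intro n ε hε
    set G : α → ℝ≥0∞ := fun x => (d x)⁻¹ * ‖f n x‖ₑ with hG_def
    have hfn_ae : AEMeasurable (fun x => ‖f n x‖ₑ) μ' := ((hf n).1.mono_ac hμ'μ).enorm
    have hkey : ∀ s, MeasurableSet s → ∫⁻ x in s, ‖f n x‖ₑ ∂μ = ∫⁻ x in s, G x ∂μ' := by
      intro s hs
      calc ∫⁻ x in s, ‖f n x‖ₑ ∂μ
          = ∫⁻ x in s, ‖f n x‖ₑ ∂(μ'.withDensity fun x => (d x)⁻¹) := by rw [hμeq]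
        _ = ∫⁻ x in s, ((fun x => (d x)⁻¹) * fun x => ‖f n x‖ₑ) x ∂μ' :=
            setLIntegral_withDensity_eq_lintegral_mul₀ hd_meas.inv.aemeasurable hfn_ae hs
        _ = ∫⁻ x in s, G x ∂μ' := rfl
    have hG_int : ∫⁻ x, G x ∂μ' ≠ ∞ := by
      have h1 := hkey univ MeasurableSet.univ
      simp only [Measure.restrict_univ] at h1
      have h2 : ∫⁻ x, ‖f n x‖ₑ ∂μ < ∞ := (hf n).2
      rw [← h1]
      exact h2.ne
    obtain ⟨δ, hδ, hδ'⟩ := exists_pos_setLIntegral_lt_of_measure_lt hG_int hε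
    exact ⟨δ, hδ, fun s hs hsδ => by rw [hkey s hs]; exact hδ' s hsδ⟩
  -- (d) the Cauchy property of `∫ f n φ` for `[0,1]`-valued test functions
  have hC : ∀ φ : α → ℝ, AEStronglyMeasurable φ μ → (∀ x, 0 ≤ φ x) → (∀ x, φ x ≤ 1) →
      CauchySeq fun n => ∫ x, f n x * φ x ∂μ := by
    intro φ hφ h0 h1
    refine Filter.Tendsto.cauchySeq (hw φ 1 hφ (Eventually.of_forall fun x => ?_))
    rw [abs_of_nonneg (h0 x)]
    exact h1 x
  -- (e) Vitali–Hahn–Saks, in `eLpNorm` form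
  have hsmall : ∀ ε : ℝ, 0 < ε → ∃ δ : ℝ≥0∞, 0 < δ ∧ ∀ s, MeasurableSet s → μ' s < δ →
      ∀ n, eLpNorm (s.indicator (f n)) 1 μ ≤ ENNReal.ofReal ε := by
    intro ε hε
    obtain ⟨δ, hδ, h⟩ := vitaliHahnSaks_setIntegral hμμ' hf hac hC (half_pos hε)
    refine ⟨δ, hδ, fun s hs hsδ n => ?_⟩
    have := eLpNorm_indicator_le_of_forall_abs_setIntegral_le (hf n) hs
      (fun t ht hts => h t ht ((measure_mono hts).trans_lt hsδ) n)
    rwa [show 2 * (ε / 2) = ε by ring] at this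
  refine ⟨⟨fun n => (hf n).1, fun ε hε => ?_, hbound⟩, ?_⟩
  · -- equi-integrability
    obtain ⟨δ, hδ, h⟩ := hsmall ε hε
    obtain ⟨δ', hδ'0, hδ'⟩ := ENNReal.lt_iff_exists_nnreal_btwn.1 hδ
    refine ⟨δ', NNReal.coe_pos.2 (by exact_mod_cast hδ'0), fun n s hs hμs => h s hs ?_ n⟩
    calc μ' s ≤ μ s := Measure.le_iff'.1 hμ'le s
      _ ≤ ENNReal.ofReal δ' := hμs
      _ = δ' := ENNReal.ofReal_coe_nnreal
      _ < δ := hδ'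
  · -- uniform tightness
    refine (unifTight_iff_real _ _ _).2 fun ε hε => ?_
    obtain ⟨δ, hδ, h⟩ := hsmall ε hε
    set S : ℕ → Set α := spanningSets μ with hS_def
    have hanti : Antitone fun k => (S k)ᶜ := fun k l hkl =>
      compl_subset_compl.2 (monotone_spanningSets μ hkl)
    have htend : Tendsto (fun k => μ' (S k)ᶜ) atTop (𝓝 0) := by
      have h1 := tendsto_measure_iInter_atTop (μ := μ')
        (fun k => ((measurableSet_spanningSets μ k).compl).nullMeasurableSet) hanti
        ⟨0, measure_ne_top μ' _⟩
      have h0 : μ' (⋂ k, (S k)ᶜ) = 0 := by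
        rw [← compl_iUnion, hS_def, iUnion_spanningSets, compl_univ, measure_empty]
      rw [h0] at h1
      exact h1
    obtain ⟨k, hk⟩ := (htend.eventually (gt_mem_nhds hδ)).exists
    exact ⟨S k, (measure_spanningSets_lt_top μ k).ne,
      fun n => h _ (measurableSet_spanningSets μ k).compl hk n⟩

end Literature.Analysis.FunctionSpaces
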